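import Mathlib
import HarnessLib
import Summits.HubbardSuperconductivity.HubbardSuperconductivity.Theorems.KLProgrammeC4aCausticWindowCoverThresholds
import Summits.HubbardSuperconductivity.HubbardSuperconductivity.Theorems.KLProgrammeC4aFoldBoxThresholds

/-!
# Route `KLProgramme` — crux C4a, S3 brick (B4) «(U1)-ZONE-ASSEMBLY» part 4: THE ZONE THEOREM'S THRESHOLDS ARE JOINTLY FEASIBLE — positive `n`-free numbers meeting
# EVERY smallness row of `…C4aZoneAssembly.zone_integral_le` simultaneously, for all tiles `ℓ ≤ ℓ₀`, levels `0 < hi ≤ hi₀`, radii `|ρ| ≤ ρ_C` and loop windows of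
# length `≤ L` (non-vacuity certificate of the generic zone)

Cell `gate-hubbard-kl`, seat hubbard-kl-k3c3-p3 (g34; row «implicit-function / monotonicity route for μ(n)»).  Located brick for the (C)-closer lane / the (M4)
assembly of the umklapp first-order ϑ-layer (stub (C) `stub_twoLeg_curvature` of `KLRegimeEngineV17F2`, stmt-HubbardSuperconductivity-20437), memo
HOME/hubbard-kl-k3c3-p3/U1-CAUSTIC-SUP.md §16.

WHY.  `zone_integral_le` carries 17 smallness rows in 16 threshold parameters (tile width `ℓ`, loop margin `W_m`, window bound `Wφ`, witness scale `τ₀`, the fold-box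
budget `Δ`, the cover budget `Δc`, the cover window `ω`, the antipodal margin `η₀`, the no-witness scales `d₁, λ, ε`, the level cutoff `hi`, the ceilings `Γ, Γ'`, the radius
`|ρ|`, the loop-window length).  This file shows they are met at once by `n`-free numbers (functions of the Sizes / `FrameOK` constants, `w`, `K_c`, `K₀`, `r`, `r₀` only), so the
zone theorem is not vacuous and its bound is a genuine `n`-free constant.  ORDER OF CHOICE: the cover thresholds (`…C4aCausticWindowCoverThresholds.exists_coverThresholds_frame`:
`η₀, τ_c, L_c, Δc, ω, ρ_C`) and the fold-box thresholds (`…C4aFoldBoxThresholds.exists_foldBox_thresholds`: `W_f, t`, `Δ := t + 2msD₁W_f`) first; then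
`Wφ := min(W_f, L_c)`, `W_m := Wφ/4`, and the fold rows are transported from `(s·dist₀, s·hi, W_f)` to `(dist₀, hi, Wφ)` with `s := 4W_f/Wφ ≥ 4` by LINEARITY of the slope
row and MONOTONICITY of the modulus / rate rows (this is how the margin `W_m < Wφ/2` is paid: by shrinking `dist₀ = τ₀ + msD₁ℓ` and `hi` by the factor `s`); then
`τ₀ := min(τ_c, t/(2s))`, `ℓ₀ := min(L_c, t/(2s·msD₁))`; then the no-witness margin `T(λ, ε, hi) ≤ τ₀` by `λ, ε, hi` small (`T` is linear in them), `d₁ := ε/4`,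
the loop-window length `L := min(Wφ/2, ε/(4(K₁msD₁+1)))` from `heps`, `hi₀` from seven upper bounds, `ρ_C` below `r` and `3/80`, and the ceilings `Γ := K₀ + hi₀ + κ̄ℓ₀`
(`κ̄` = the transversal floor at `ℓ = 0`, `ρ = 0` without its negative part), `Γ' := K₀ + (w u_min²/2)Wφ²`.
* **`exists_zoneThresholds`** (HEADLINE): the 28 constant facts and, for all `0 ≤ ℓ ≤ ℓ₀`, `0 < hi ≤ hi₀`, `|ρ| ≤ ρ_C`, `0 ≤ L_w ≤ L`, the 17 rows of `zone_integral_le`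
  LITERALLY (`L_w` in the place of `φb − φa`; `K₁Δ ≤ D_fl` stays the kernel side's, `lo ≤ hi` the scale's).
Elementary real arithmetic on landed constants; nothing about the model beyond the Sizes binders; nothing asserts (C), K3 or superconductivity.
References: FST II CPAM 51 (1998) §3 [cite: FeldmanSalmhoferTrubowitz1998]; BGM 2003 §7.1 [cite: BenfattoGiulianiMastropietro2003].
-/

noncomputable section

namespace Summit.HubbardSuperconductivity.HubbardSuperconductivity.Theorems.C4a

set_option linter.dupNamespace false -- summit = problem name (single-conjunct summit), D-0017

open Real Set
open Literature.MathematicalPhysics.QuantumLattice Literature.MathematicalPhysics.QuantumLattice.BandSectorCounting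
open Literature.MathematicalPhysics.QuantumLattice.FermiRG
open Summit.HubbardSuperconductivity.HubbardSuperconductivity.Theorems.KLRegimeSplit
open Summit.HubbardSuperconductivity.HubbardSuperconductivity.Theorems.DispersionFlow
open Summit.HubbardSuperconductivity.HubbardSuperconductivity.Theorems.PerturbedFermiCurve

section Sizes

variable {K : TrigPolyC4v} {A : ℝ} (hA : ∀ p : Momentum, ∀ j ≤ 2, ‖iteratedFDeriv ℝ j (frameShift K) p‖ ≤ A) (hA20 : A ≤ 1 / 20)
  (hd : klCurveD ≤ (bandBounds (show (-4 : ℝ) < -1.1 by norm_num) (show (-1.1 : ℝ) ≤ -0.1 by norm_num)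
    (show (-0.1 : ℝ) < 0 by norm_num)).Dtmin - 2 * A)
  {μ r : ℝ} (hr : 0 < r) (hlo : (-1.1 : ℝ) < μ - r - A) (hhi : μ + r + A < -0.1)
  {A₃ A₄ : ℝ} (hA₃ : ∀ p : Momentum, ‖iteratedFDeriv ℝ 3 (frameShift K) p‖ ≤ A₃)
  (hA₄ : ∀ p : Momentum, ‖iteratedFDeriv ℝ 4 (frameShift K) p‖ ≤ A₄)
  {K₁ K₂ K₃ : ℝ} (hK₁ : ∀ p : Momentum, ‖fderiv ℝ (frameLevel μ K) p‖ ≤ K₁) (hK₂ : ∀ p : Momentum, ‖iteratedFDeriv ℝ 2 (frameLevel μ K) p‖ ≤ K₂)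
  (hK₃ : ∀ p : Momentum, ‖iteratedFDeriv ℝ 3 (frameLevel μ K) p‖ ≤ K₃)
include hA hA20 hd hr hlo hhi hA₃ hA₄ hK₁ hK₂ hK₃

set_option maxHeartbeats 400000 in
/-- **THE ZONE THEOREM'S THRESHOLDS ARE JOINTLY FEASIBLE** (HEADLINE; see the module docstring). -/
theorem exists_zoneThresholds {w Kc K₀ r₀ : ℝ} (hw : 0 < w) (hKc : 0 ≤ Kc) (hK₀ : 0 < K₀) (hr₀ : 0 < r₀) :
    ∃ ℓ₀ L Wm Wφ τ₀ Δ Δc ω η₀ d₁ lam eps hi₀ ρC Γ Γ' : ℝ,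
      0 < ℓ₀ ∧ 0 < L ∧ 0 < Wm ∧ 0 < Wφ ∧ 0 < τ₀ ∧ 0 < Δ ∧ 0 < Δc ∧ 0 < ω ∧ 0 < η₀ ∧ 0 < d₁ ∧ 0 < lam ∧ 0 < eps ∧ 0 < hi₀ ∧ 0 < ρC ∧
      ρC < r ∧ ρC < 3 / 80 ∧ hi₀ < r ∧ hi₀ < r₀ ∧ hi₀ ≤ K₀ ∧ Δ ≤ 3 / 10 ∧ Δ ≤ (bandBounds (show (-4 : ℝ) < -1.1 by norm_num) (show (-1.1 : ℝ) ≤ -0.1 by norm_num) (show (-0.1 : ℝ) < 0 by norm_num)).umin ∧ K₁ * Δ < r ∧ Δc ≤ 3 / 10 ∧ K₁ * Δc < r ∧ eps ≤ r ∧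
      K₀ ≤ Γ ∧ K₀ ≤ Γ' ∧
      ∀ ℓ hi ρ Lw : ℝ, 0 ≤ ℓ → ℓ ≤ ℓ₀ → 0 < hi → hi ≤ hi₀ → |ρ| ≤ ρC → 0 ≤ Lw → Lw ≤ L →
        Lw + 2 * Wm ≤ Wφ ∧
        K₃ * (τ₀ + msD A₃ A₄ 1 * (ℓ) +
              hi / ((bandBounds (show (-4 : ℝ) < -1.1 by norm_num) (show (-1.1 : ℝ) ≤ -0.1 by norm_num) (show (-0.1 : ℝ) < 0 by norm_num)).Dtmin - 2 * A) +
              msD A₃ A₄ 1 * Wφ) * msD A₃ A₄ 1 ^ 2 +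
          K₂ * (radialRowOneConst A ((bandBounds (show (-4 : ℝ) < -1.1 by norm_num) (show (-1.1 : ℝ) ≤ -0.1 by norm_num) (show (-0.1 : ℝ) < 0 by norm_num)).Dtmin -
                2 * A) * hi + msD A₃ A₄ 2 * Wφ) * (msD A₃ A₄ 1 + msD A₃ A₄ 1) +
          K₂ * (τ₀ + msD A₃ A₄ 1 * (ℓ) +
              hi / ((bandBounds (show (-4 : ℝ) < -1.1 by norm_num) (show (-1.1 : ℝ) ≤ -0.1 by norm_num) (show (-0.1 : ℝ) < 0 by norm_num)).Dtmin - 2 * A) +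
              msD A₃ A₄ 1 * Wφ) * msD A₃ A₄ 2 +
          K₁ * ((uRowTwoConst A A₃ ((bandBounds (show (-4 : ℝ) < -1.1 by norm_num) (show (-1.1 : ℝ) ≤ -0.1 by norm_num) (show (-0.1 : ℝ) < 0 by norm_num)).Dtmin -
                  2 * A) +
                1 / ((bandBounds (show (-4 : ℝ) < -1.1 by norm_num) (show (-1.1 : ℝ) ≤ -0.1 by norm_num) (show (-0.1 : ℝ) < 0 by norm_num)).Dtmin - 2 * A) +
                2 * (radialRowOneConst A ((bandBounds (show (-4 : ℝ) < -1.1 by norm_num) (show (-1.1 : ℝ) ≤ -0.1 by norm_num)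
                    (show (-0.1 : ℝ) < 0 by norm_num)).Dtmin - 2 * A) -
                  1 / ((bandBounds (show (-4 : ℝ) < -1.1 by norm_num) (show (-1.1 : ℝ) ≤ -0.1 by norm_num) (show (-0.1 : ℝ) < 0 by norm_num)).Dtmin - 2 * A))) *
              hi + msD A₃ A₄ 3 * Wφ) ≤
        w * (bandBounds (show (-4 : ℝ) < -1.1 by norm_num) (show (-1.1 : ℝ) ≤ -0.1 by norm_num) (show (-0.1 : ℝ) < 0 by norm_num)).umin ^ 2 ∧
        K₂ * msD A₃ A₄ 1 * (τ₀ + msD A₃ A₄ 1 * (ℓ) +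
        2 * (hi / ((bandBounds (show (-4 : ℝ) < -1.1 by norm_num) (show (-1.1 : ℝ) ≤ -0.1 by norm_num) (show (-0.1 : ℝ) < 0 by norm_num)).Dtmin - 2 * A))) ≤
      w * (bandBounds (show (-4 : ℝ) < -1.1 by norm_num) (show (-1.1 : ℝ) ≤ -0.1 by norm_num) (show (-0.1 : ℝ) < 0 by norm_num)).umin ^ 2 * Wm ∧
        K₂ * (τ₀ + msD A₃ A₄ 1 * (ℓ) +
          2 * (hi / ((bandBounds (show (-4 : ℝ) < -1.1 by norm_num) (show (-1.1 : ℝ) ≤ -0.1 by norm_num) (show (-0.1 : ℝ) < 0 by norm_num)).Dtmin - 2 * A) +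
            msD A₃ A₄ 1 * Wφ)) /
        ((bandBounds (show (-4 : ℝ) < -1.1 by norm_num) (show (-1.1 : ℝ) ≤ -0.1 by norm_num) (show (-0.1 : ℝ) < 0 by norm_num)).Dtmin - 2 * A) ≤ 1 / 2 ∧
        hi / 2 ≤ Γ ∧ w * (bandBounds (show (-4 : ℝ) < -1.1 by norm_num) (show (-1.1 : ℝ) ≤ -0.1 by norm_num) (show (-0.1 : ℝ) < 0 by norm_num)).umin ^ 2 / 2 * (Lw + 2 * Wm) ^ 2 ≤ Γ' ∧
        τ₀ + msD A₃ A₄ 1 * (ℓ) + 2 * (msD A₃ A₄ 1 * Wφ) ≤ Δ ∧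
        τ₀ + 2 * (msD A₃ A₄ 1 * η₀ + |ρ| / ((bandBounds (show (-4 : ℝ) < -1.1 by norm_num) (show (-1.1 : ℝ) ≤ -0.1 by norm_num) (show (-0.1 : ℝ) < 0 by norm_num)).Dtmin - 2 * A)) ≤ 3 / 5 ∧
        τ₀ + msD A₃ A₄ 1 * ((ℓ) + (Lw + 2 * Wm)) ≤ Δc ∧ η₀ + (ℓ) ≤ ω ∧ Lw + 2 * Wm ≤ ω ∧
        0 < 2 / π * (((bandBounds (show (-4 : ℝ) < -1.1 by norm_num) (show (-1.1 : ℝ) ≤ -0.1 by norm_num) (show (-0.1 : ℝ) < 0 by norm_num)).Dtmin - 2 * A) * (bandBounds (show (-4 : ℝ) < -1.1 by norm_num) (show (-1.1 : ℝ) ≤ -0.1 by norm_num) (show (-0.1 : ℝ) < 0 by norm_num)).umin) *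
      ((bandBounds (show (-4 : ℝ) < -1.1 by norm_num) (show (-1.1 : ℝ) ≤ -0.1 by norm_num) (show (-0.1 : ℝ) < 0 by norm_num)).umin * (3 / 200) / (4 + 2 * A) * (η₀ - (ℓ) - π / (2 * (bandBounds (show (-4 : ℝ) < -1.1 by norm_num) (show (-1.1 : ℝ) ≤ -0.1 by norm_num) (show (-0.1 : ℝ) < 0 by norm_num)).umin) * Δc) - π * 7 * (K₁ * Δc + |ρ|) / ((bandBounds (show (-4 : ℝ) < -1.1 by norm_num) (show (-1.1 : ℝ) ≤ -0.1 by norm_num) (show (-0.1 : ℝ) < 0 by norm_num)).Dtmin - 2 * A) ^ 2) ∧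
        2 / π * (((bandBounds (show (-4 : ℝ) < -1.1 by norm_num) (show (-1.1 : ℝ) ≤ -0.1 by norm_num) (show (-0.1 : ℝ) < 0 by norm_num)).Dtmin - 2 * A) * (bandBounds (show (-4 : ℝ) < -1.1 by norm_num) (show (-1.1 : ℝ) ≤ -0.1 by norm_num) (show (-0.1 : ℝ) < 0 by norm_num)).umin) *
      ((bandBounds (show (-4 : ℝ) < -1.1 by norm_num) (show (-1.1 : ℝ) ≤ -0.1 by norm_num) (show (-0.1 : ℝ) < 0 by norm_num)).umin * (3 / 200) / (4 + 2 * A) * (η₀ - (ℓ) - π / (2 * (bandBounds (show (-4 : ℝ) < -1.1 by norm_num) (show (-1.1 : ℝ) ≤ -0.1 by norm_num) (show (-0.1 : ℝ) < 0 by norm_num)).umin) * Δc) - π * 7 * (K₁ * Δc + |ρ|) / ((bandBounds (show (-4 : ℝ) < -1.1 by norm_num) (show (-1.1 : ℝ) ≤ -0.1 by norm_num) (show (-0.1 : ℝ) < 0 by norm_num)).Dtmin - 2 * A) ^ 2) * (ℓ) ≤ Γ ∧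
        2 * (2 * K₃ * Δc * msD A₃ A₄ 1 ^ 2 +
        4 * K₂ * (radialRowOneConst A ((bandBounds (show (-4 : ℝ) < -1.1 by norm_num) (show (-1.1 : ℝ) ≤ -0.1 by norm_num) (show (-0.1 : ℝ) < 0 by norm_num)).Dtmin - 2 * A) * |ρ| + msD A₃ A₄ 2 * ω) * msD A₃ A₄ 1 +
        K₂ * Δc * msD A₃ A₄ 2 +
        K₁ * ((uRowTwoConst A A₃ ((bandBounds (show (-4 : ℝ) < -1.1 by norm_num) (show (-1.1 : ℝ) ≤ -0.1 by norm_num) (show (-0.1 : ℝ) < 0 by norm_num)).Dtmin - 2 * A) + 1 / ((bandBounds (show (-4 : ℝ) < -1.1 by norm_num) (show (-1.1 : ℝ) ≤ -0.1 by norm_num) (show (-0.1 : ℝ) < 0 by norm_num)).Dtmin - 2 * A) +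
              2 * (radialRowOneConst A ((bandBounds (show (-4 : ℝ) < -1.1 by norm_num) (show (-1.1 : ℝ) ≤ -0.1 by norm_num) (show (-0.1 : ℝ) < 0 by norm_num)).Dtmin - 2 * A) - 1 / ((bandBounds (show (-4 : ℝ) < -1.1 by norm_num) (show (-1.1 : ℝ) ≤ -0.1 by norm_num) (show (-0.1 : ℝ) < 0 by norm_num)).Dtmin - 2 * A))) * |ρ| + msD A₃ A₄ 3 * ω)) < 9 / 400 * (bandBounds (show (-4 : ℝ) < -1.1 by norm_num) (show (-1.1 : ℝ) ≤ -0.1 by norm_num) (show (-0.1 : ℝ) < 0 by norm_num)).umin ^ 2 ∧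
        K₁ * (hi / ((bandBounds (show (-4 : ℝ) < -1.1 by norm_num) (show (-1.1 : ℝ) ≤ -0.1 by norm_num) (show (-0.1 : ℝ) < 0 by norm_num)).Dtmin - 2 * A)) ≤ d₁ / 2 ∧
        d₁ + K₁ * (msD A₃ A₄ 1 * (Lw)) + K₁ * (hi / ((bandBounds (show (-4 : ℝ) < -1.1 by norm_num) (show (-1.1 : ℝ) ≤ -0.1 by norm_num) (show (-0.1 : ℝ) < 0 by norm_num)).Dtmin - 2 * A)) + hi ≤ eps ∧
        msD A₃ A₄ 1 *
            ((π / 2 * lam /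
                  (((bandBounds (show (-4 : ℝ) < -1.1 by norm_num) (show (-1.1 : ℝ) ≤ -0.1 by norm_num) (show (-0.1 : ℝ) < 0 by norm_num)).Dtmin -
                      2 * A) *
                    (bandBounds (show (-4 : ℝ) < -1.1 by norm_num) (show (-1.1 : ℝ) ≤ -0.1 by norm_num) (show (-0.1 : ℝ) < 0 by norm_num)).umin) +
                π * Kc * eps / ((bandBounds (show (-4 : ℝ) < -1.1 by norm_num) (show (-1.1 : ℝ) ≤ -0.1 by norm_num) (show (-0.1 : ℝ) < 0 by norm_num)).Dtmin - 2 * A) ^ 2) /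
              ((bandBounds (show (-4 : ℝ) < -1.1 by norm_num) (show (-1.1 : ℝ) ≤ -0.1 by norm_num) (show (-0.1 : ℝ) < 0 by norm_num)).umin * w /
                (4 + 2 * A))) +
          (2 * hi + eps) / ((bandBounds (show (-4 : ℝ) < -1.1 by norm_num) (show (-1.1 : ℝ) ≤ -0.1 by norm_num) (show (-0.1 : ℝ) < 0 by norm_num)).Dtmin -
            2 * A) ≤ τ₀ := by
  -- (1) the cover thresholds, (2) the fold-box thresholds
  obtain ⟨η₀, τc, Lc, Δc, ω, ρC, hη0, hτc0, hLc0, hΔc0, hω0, hρC0, hsame, hΔc, hΔc1, hKΔc, hκ, hω₁, hω₂, hbud⟩ :=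
    exists_coverThresholds_frame hA hA20 hd hr hlo hhi hA₃ hA₄ hK₁ hK₂ hK₃
  obtain ⟨Wf, t, hWf0, ht0, hKΔ, hΔ1, hΔu, hfold⟩ := exists_foldBox_thresholds hA hA20 hd hr hlo hhi hA₃ hA₄ hK₁ hK₂ hK₃ hw
  set B := (bandBounds (show (-4 : ℝ) < -1.1 by norm_num) (show (-1.1 : ℝ) ≤ -0.1 by norm_num) (show (-0.1 : ℝ) < 0 by norm_num)) with hBdef
  -- signs of the sizes
  have hA0 : 0 ≤ A := (norm_nonneg _).trans (hA 0 0 (by norm_num))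
  have hA₃0 : 0 ≤ A₃ := (norm_nonneg _).trans (hA₃ 0)
  have hDt : 0 < B.Dtmin - 2 * A := by have := klCurveD_pos; linarith only [this, hd]
  have hu : 0 < B.umin := B.umin_pos
  have hK₁0 : 0 ≤ K₁ := (norm_nonneg _).trans (hK₁ 0)
  have hK₂0 : 0 ≤ K₂ := (norm_nonneg _).trans (hK₂ 0)
  have hK₃0 : 0 ≤ K₃ := (norm_nonneg _).trans (hK₃ 0)
  have h0r : |(0 : ℝ)| < r := by simpa using hr
  have hD1 : 0 < msD A₃ A₄ 1 := msD_one_pos A₃ A₄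
  have hD2 : 0 ≤ msD A₃ A₄ 2 := (msD_two_pos A₃ A₄).le
  have hD3 : 0 ≤ msD A₃ A₄ 3 := (norm_nonneg _).trans (norm_iteratedDeriv_levelPoint_le hA hA20 hd hlo hhi hA₃ hA₄ h0r (by norm_num) (by norm_num) 0)
  have hRR : 0 ≤ radialRowOneConst A (B.Dtmin - 2 * A) := radialRowOneConst_nonneg hA0 hDt
  have hRR' : 0 ≤ radialRowOneConst A (B.Dtmin - 2 * A) - 1 / (B.Dtmin - 2 * A) := radialRowOneConst_sub_inv_nonneg hA0 hDt
  have hUR : 0 ≤ uRowTwoConst A A₃ (B.Dtmin - 2 * A) := uRowTwoConst_nonneg hA0 hA₃0 hDt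
  have hπ := Real.pi_pos
  set d := B.Dtmin - 2 * A with hddef
  have hd0 : d ≠ 0 := hDt.ne'
  have hu0 : B.umin ≠ 0 := hu.ne'
  have hw0 : w ≠ 0 := hw.ne'
  have hA4 : (4 : ℝ) + 2 * A ≠ 0 := by positivity
  -- (3) the window sizes and the transport factor `s`
  obtain ⟨Wt, hWt⟩ : ∃ Wt : ℝ, Wt = min Wf Lc := ⟨_, rfl⟩
  have hWt0 : 0 < Wt := by rw [hWt]; exact lt_min hWf0 hLc0
  have hWtf : Wt ≤ Wf := by rw [hWt]; exact min_le_left _ _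
  have hWtc : Wt ≤ Lc := by rw [hWt]; exact min_le_right _ _
  obtain ⟨s, hs⟩ : ∃ s : ℝ, s = 4 * Wf / Wt := ⟨_, rfl⟩
  have hs0 : 0 < s := by rw [hs]; positivity
  have hs4 : 4 ≤ s := by rw [hs, le_div_iff₀ hWt0]; linarith only [hWtf]
  have hs1 : 1 ≤ s := by linarith only [hs4]
  have hsne : s ≠ 0 := hs0.ne'
  have hWm_eq : Wf / s = Wt / 4 := by rw [hs]; field_simp
  -- (4) the witness scale and the tile bound
  obtain ⟨τ₀, hτ₀⟩ : ∃ τ₀ : ℝ, τ₀ = min τc (t / (2 * s)) := ⟨_, rfl⟩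
  have hτ00 : 0 < τ₀ := by rw [hτ₀]; exact lt_min hτc0 (by positivity)
  have hτ₀c : τ₀ ≤ τc := by rw [hτ₀]; exact min_le_left _ _
  have hτ₀t : τ₀ ≤ t / (2 * s) := by rw [hτ₀]; exact min_le_right _ _
  obtain ⟨ℓ₀, hℓ₀⟩ : ∃ ℓ₀ : ℝ, ℓ₀ = min Lc (t / (2 * s * msD A₃ A₄ 1)) := ⟨_, rfl⟩
  have hℓ00 : 0 < ℓ₀ := by rw [hℓ₀]; exact lt_min hLc0 (div_pos ht0 (mul_pos (mul_pos (by norm_num) hs0) hD1))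
  have hℓ₀c : ℓ₀ ≤ Lc := by rw [hℓ₀]; exact min_le_left _ _
  have hℓ₀t : ℓ₀ ≤ t / (2 * s * msD A₃ A₄ 1) := by rw [hℓ₀]; exact min_le_right _ _
  -- (5) the no-witness margin scales
  obtain ⟨a₁, ha₁⟩ : ∃ a₁ : ℝ, a₁ = msD A₃ A₄ 1 * (π / 2 / (d * B.umin)) / (B.umin * w / (4 + 2 * A)) := ⟨_, rfl⟩
  obtain ⟨a₂, ha₂⟩ : ∃ a₂ : ℝ, a₂ = msD A₃ A₄ 1 * (π * Kc / d ^ 2) / (B.umin * w / (4 + 2 * A)) := ⟨_, rfl⟩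
  have ha₁0 : 0 ≤ a₁ := by rw [ha₁]; positivity
  have ha₂0 : 0 ≤ a₂ := by rw [ha₂]; positivity
  obtain ⟨lam, hlam⟩ : ∃ lam : ℝ, lam = τ₀ / (4 * (a₁ + 1)) := ⟨_, rfl⟩
  have hlam0 : 0 < lam := by rw [hlam]; positivity
  obtain ⟨eps, heps⟩ : ∃ eps : ℝ, eps = min r (τ₀ / (4 * (a₂ + 1 / d + 1))) := ⟨_, rfl⟩
  have heps0 : 0 < eps := by rw [heps]; exact lt_min hr (by positivity)
  have hepsr : eps ≤ r := by rw [heps]; exact min_le_left _ _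
  have hepsτ : eps ≤ τ₀ / (4 * (a₂ + 1 / d + 1)) := by rw [heps]; exact min_le_right _ _
  -- (6) the far scale and the loop-window length
  obtain ⟨d₁, hd₁⟩ : ∃ d₁ : ℝ, d₁ = eps / 4 := ⟨_, rfl⟩
  have hd₁0 : 0 < d₁ := by rw [hd₁]; positivity
  obtain ⟨L, hL⟩ : ∃ L : ℝ, L = min (Wt / 2) (eps / (4 * (K₁ * msD A₃ A₄ 1 + 1))) := ⟨_, rfl⟩
  have hL0 : 0 < L := by rw [hL]; exact lt_min (by positivity) (by positivity)
  have hLW : L ≤ Wt / 2 := by rw [hL]; exact min_le_left _ _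
  have hLe : L ≤ eps / (4 * (K₁ * msD A₃ A₄ 1 + 1)) := by rw [hL]; exact min_le_right _ _
  -- (7) the level cutoff
  obtain ⟨hi₀, hhi₀⟩ : ∃ hi₀ : ℝ, hi₀ = min (min (min (t / s) (r₀ / 2)) (min K₀ (r / 2))) (min (τ₀ * d / 16) (eps * d / (8 * (K₁ + d + 1)))) := ⟨_, rfl⟩
  have hhi00 : 0 < hi₀ := by
    rw [hhi₀]
    refine lt_min (lt_min (lt_min (by positivity) (by positivity)) (lt_min hK₀ (by positivity))) (lt_min (by positivity) (by positivity))
  have hhi₀s : hi₀ ≤ t / s := by rw [hhi₀]; exact (min_le_left _ _).trans ((min_le_left _ _).trans (min_le_left _ _))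
  have hhi₀r₀ : hi₀ ≤ r₀ / 2 := by rw [hhi₀]; exact (min_le_left _ _).trans ((min_le_left _ _).trans (min_le_right _ _))
  have hhi₀K : hi₀ ≤ K₀ := by rw [hhi₀]; exact (min_le_left _ _).trans ((min_le_right _ _).trans (min_le_left _ _))
  have hhi₀r : hi₀ ≤ r / 2 := by rw [hhi₀]; exact (min_le_left _ _).trans ((min_le_right _ _).trans (min_le_right _ _))
  have hhi₀τ : hi₀ ≤ τ₀ * d / 16 := by rw [hhi₀]; exact (min_le_right _ _).trans (min_le_left _ _)
  have hhi₀e : hi₀ ≤ eps * d / (8 * (K₁ + d + 1)) := by rw [hhi₀]; exact (min_le_right _ _).trans (min_le_right _ _)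
  -- (8) the radius
  obtain ⟨ρC', hρC'⟩ : ∃ ρC' : ℝ, ρC' = min ρC (min (r / 2) (1 / 40)) := ⟨_, rfl⟩
  have hρC'0 : 0 < ρC' := by rw [hρC']; exact lt_min hρC0 (lt_min (by positivity) (by norm_num))
  have hρC'C : ρC' ≤ ρC := by rw [hρC']; exact min_le_left _ _
  have hρC'r : ρC' < r := by rw [hρC']; exact (min_le_right _ _).trans_lt ((min_le_left _ _).trans_lt (by linarith))
  have hρC'1 : ρC' < 3 / 80 := by rw [hρC']; exact (min_le_right _ _).trans_lt ((min_le_right _ _).trans_lt (by norm_num))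
  -- (9) the ceilings
  obtain ⟨κb, hκb⟩ : ∃ κb : ℝ, κb = 2 / π * (d * B.umin) * (B.umin * (3 / 200) / (4 + 2 * A) * (η₀ - π / (2 * B.umin) * Δc)) := ⟨_, rfl⟩
  have hκb0 : 0 ≤ κb := by
    -- the transversal floor at `ℓ = 0`, `ρ = 0` is positive and `≤ κb`
    have h := hκ 0 0 hLc0.le (by rw [abs_zero]; exact hρC0.le)
    rw [abs_zero, add_zero, sub_zero] at h
    have h2 : 0 ≤ π * 7 * (K₁ * Δc) / d ^ 2 := by positivity
    have h3 : 0 < 2 / π * (d * B.umin) := by positivity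
    rw [hκb]
    have h4 : 0 < B.umin * (3 / 200) / (4 + 2 * A) * (η₀ - π / (2 * B.umin) * Δc) - π * 7 * (K₁ * Δc) / d ^ 2 := by
      by_contra hneg
      push Not at hneg
      have := mul_nonpos_iff.2 (Or.inl ⟨h3.le, hneg⟩)
      linarith only [this, h]
    exact mul_nonneg h3.le (by linarith only [h4, h2])
  obtain ⟨Γ, hΓ⟩ : ∃ Γ : ℝ, Γ = K₀ + hi₀ + κb * ℓ₀ := ⟨_, rfl⟩
  obtain ⟨Γ', hΓ'⟩ : ∃ Γ' : ℝ, Γ' = K₀ + w * B.umin ^ 2 / 2 * Wt ^ 2 := ⟨_, rfl⟩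
  have hκℓ0 : 0 ≤ κb * ℓ₀ := mul_nonneg hκb0 hℓ00.le
  have hΓK : K₀ ≤ Γ := by rw [hΓ]; linarith only [hhi00.le, hκℓ0]
  have hΓ'K : K₀ ≤ Γ' := by
    rw [hΓ']; have : 0 ≤ w * B.umin ^ 2 / 2 * Wt ^ 2 := by positivity
    linarith only [this]
  refine ⟨ℓ₀, L, Wt / 4, Wt, τ₀, t + 2 * (msD A₃ A₄ 1 * Wf), Δc, ω, η₀, d₁, lam, eps, hi₀, ρC', Γ, Γ', hℓ00, hL0, by positivity, hWt0, hτ00,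
    by linarith only [ht0, mul_pos hD1 hWf0],
    hΔc0, hω0, hη0, hd₁0, hlam0, heps0, hhi00, hρC'0, hρC'r, hρC'1, by linarith only [hhi₀r, hr], by linarith only [hhi₀r₀, hr₀], hhi₀K, hΔ1, hΔu, hKΔ, hΔc1, hKΔc, hepsr, hΓK, hΓ'K,
    fun ℓ hi ρ Lw hℓ0 hℓ hhi0 hhi hρ hLw0 hLw => ?_⟩
  -- the rows, for one admissible `(ℓ, hi, ρ, Lw)`
  have hρC : |ρ| ≤ ρC := hρ.trans hρC'C
  have hℓc : ℓ ≤ Lc := hℓ.trans hℓ₀c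
  have hwin : Lw + 2 * (Wt / 4) ≤ Wt := by linarith only [hLw, hLW]
  have hwin0 : 0 ≤ Lw + 2 * (Wt / 4) := by positivity
  -- the fold rows at `(s·dist₀, s·hi, W_f)`
  have hDst0 : 0 ≤ τ₀ + msD A₃ A₄ 1 * ℓ := by positivity
  have hsD : s * (τ₀ + msD A₃ A₄ 1 * ℓ) ≤ t := by
    have h1 : s * τ₀ ≤ t / 2 := by
      have := mul_le_mul_of_nonneg_left hτ₀t hs0.le
      rwa [show s * (t / (2 * s)) = t / 2 by field_simp] at this
    have h2 : s * (msD A₃ A₄ 1 * ℓ) ≤ t / 2 := by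
      have := mul_le_mul_of_nonneg_left (hℓ.trans hℓ₀t) (mul_nonneg hs0.le hD1.le)
      rwa [show s * msD A₃ A₄ 1 * (t / (2 * s * msD A₃ A₄ 1)) = t / 2 by field_simp, mul_assoc] at this
    linarith only [h1, h2, mul_add s τ₀ (msD A₃ A₄ 1 * ℓ)]
  have hshi : s * hi ≤ t := by
    have := mul_le_mul_of_nonneg_left (hhi.trans hhi₀s) hs0.le
    rwa [show s * (t / s) = t by field_simp] at this
  have hshi0 : 0 < s * hi := mul_pos hs0 hhi0
  obtain ⟨hmodf, hslf, hrtf⟩ := hfold (s * (τ₀ + msD A₃ A₄ 1 * ℓ)) (s * hi) (by positivity) hsD hshi0 hshi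
  have hD_le : τ₀ + msD A₃ A₄ 1 * ℓ ≤ s * (τ₀ + msD A₃ A₄ 1 * ℓ) := le_mul_of_one_le_left hDst0 hs1
  have hhi_le : hi ≤ s * hi := le_mul_of_one_le_left hhi0.le hs1
  have hhid_le : hi / d ≤ s * hi / d := div_le_div_of_nonneg_right hhi_le hDt.le
  have hWD : msD A₃ A₄ 1 * Wt ≤ msD A₃ A₄ 1 * Wf := mul_le_mul_of_nonneg_left hWtf hD1.le
  have hWf0' : 0 ≤ msD A₃ A₄ 1 * Wf := by positivity
  -- R2 the modulus inequality: monotone transport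
  have hR2 : K₃ * (τ₀ + msD A₃ A₄ 1 * ℓ + hi / d + msD A₃ A₄ 1 * Wt) * msD A₃ A₄ 1 ^ 2 +
        K₂ * (radialRowOneConst A d * hi + msD A₃ A₄ 2 * Wt) * (msD A₃ A₄ 1 + msD A₃ A₄ 1) +
        K₂ * (τ₀ + msD A₃ A₄ 1 * ℓ + hi / d + msD A₃ A₄ 1 * Wt) * msD A₃ A₄ 2 +
        K₁ * ((uRowTwoConst A A₃ d + 1 / d + 2 * (radialRowOneConst A d - 1 / d)) * hi + msD A₃ A₄ 3 * Wt) ≤ w * B.umin ^ 2 := by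
    refine le_trans ?_ hmodf
    have hb : 0 ≤ uRowTwoConst A A₃ d + 1 / d + 2 * (radialRowOneConst A d - 1 / d) := by positivity
    have hDD : 0 ≤ msD A₃ A₄ 1 + msD A₃ A₄ 1 := by positivity
    gcongr
  -- R3 the slope budget: linear transport
  have hR3 : K₂ * msD A₃ A₄ 1 * (τ₀ + msD A₃ A₄ 1 * ℓ + 2 * (hi / d)) ≤ w * B.umin ^ 2 * (Wt / 4) := by
    have h1 : s * (K₂ * msD A₃ A₄ 1 * (τ₀ + msD A₃ A₄ 1 * ℓ + 2 * (hi / d))) ≤ w * B.umin ^ 2 * Wf := by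
      have e : K₂ * msD A₃ A₄ 1 * (s * (τ₀ + msD A₃ A₄ 1 * ℓ) + 2 * (s * hi / d)) =
          s * (K₂ * msD A₃ A₄ 1 * (τ₀ + msD A₃ A₄ 1 * ℓ + 2 * (hi / d))) := by ring
      rw [← e]; exact hslf
    rw [← hWm_eq, show w * B.umin ^ 2 * (Wf / s) = w * B.umin ^ 2 * Wf / s by ring, le_div_iff₀ hs0]
    linarith only [h1]
  -- R4 the rate window: monotone transport
  have hR4 : K₂ * (τ₀ + msD A₃ A₄ 1 * ℓ + 2 * (hi / d + msD A₃ A₄ 1 * Wt)) / d ≤ 1 / 2 := by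
    refine le_trans ?_ hrtf
    apply div_le_div_of_nonneg_right _ hDt.le
    apply mul_le_mul_of_nonneg_left _ hK₂0
    linarith only [hD_le, hhid_le, hWD]
  -- R12/R11 the transversal floor and its ceiling
  have hR11 := hκ ℓ ρ hℓc hρC
  have hκle : 2 / π * (d * B.umin) * (B.umin * (3 / 200) / (4 + 2 * A) * (η₀ - ℓ - π / (2 * B.umin) * Δc) - π * 7 * (K₁ * Δc + |ρ|) / d ^ 2) ≤ κb := by
    rw [hκb]
    apply mul_le_mul_of_nonneg_left _ (by positivity)
    have h1 : 0 ≤ B.umin * (3 / 200) / (4 + 2 * A) * ℓ := by positivity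
    have h2 : 0 ≤ π * 7 * (K₁ * Δc + |ρ|) / d ^ 2 := by positivity
    linarith only [h1, h2]
  have hR12 : 2 / π * (d * B.umin) * (B.umin * (3 / 200) / (4 + 2 * A) * (η₀ - ℓ - π / (2 * B.umin) * Δc) - π * 7 * (K₁ * Δc + |ρ|) / d ^ 2) * ℓ ≤ Γ := by
    have h1 := mul_le_mul_of_nonneg_right hκle hℓ0
    have h2 : κb * ℓ ≤ κb * ℓ₀ := mul_le_mul_of_nonneg_left hℓ hκb0
    rw [hΓ]; linarith only [h1, h2, hK₀.le, hhi00.le]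
  -- R15/R16/R17 the no-witness scales
  have hKd1 : 0 < K₁ + d + 1 := by positivity
  have hhie : hi ≤ eps * d / (8 * (K₁ + d + 1)) := hhi.trans hhi₀e
  have hR15a : K₁ * (hi / d) ≤ eps / 8 := by
    have h1 : K₁ * (hi / d) ≤ K₁ * (eps * d / (8 * (K₁ + d + 1)) / d) := mul_le_mul_of_nonneg_left (div_le_div_of_nonneg_right hhie hDt.le) hK₁0
    have h2 : K₁ * (eps * d / (8 * (K₁ + d + 1)) / d) = eps / 8 * (K₁ / (K₁ + d + 1)) := by field_simp
    have h3 : K₁ / (K₁ + d + 1) ≤ 1 := by rw [div_le_one hKd1]; linarith only [hDt]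
    have h4 : eps / 8 * (K₁ / (K₁ + d + 1)) ≤ eps / 8 := mul_le_of_le_one_right (by positivity) h3
    linarith only [h1, h2, h4]
  have hhi8 : hi ≤ eps / 8 := by
    have h2 : eps * d / (8 * (K₁ + d + 1)) = eps / 8 * (d / (K₁ + d + 1)) := by field_simp
    have h3 : d / (K₁ + d + 1) ≤ 1 := by rw [div_le_one hKd1]; linarith only [hK₁0]
    have h4 : eps / 8 * (d / (K₁ + d + 1)) ≤ eps / 8 := mul_le_of_le_one_right (by positivity) h3
    linarith only [hhie, h2, h4]
  have hR15 : K₁ * (hi / d) ≤ d₁ / 2 := by rw [hd₁]; linarith only [hR15a]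
  have hR16 : d₁ + K₁ * (msD A₃ A₄ 1 * Lw) + K₁ * (hi / d) + hi ≤ eps := by
    have h1 : K₁ * (msD A₃ A₄ 1 * Lw) ≤ eps / 4 := by
      have h2 : K₁ * (msD A₃ A₄ 1 * Lw) ≤ K₁ * (msD A₃ A₄ 1 * (eps / (4 * (K₁ * msD A₃ A₄ 1 + 1)))) :=
        mul_le_mul_of_nonneg_left (mul_le_mul_of_nonneg_left (hLw.trans hLe) hD1.le) hK₁0
      have h3 : K₁ * (msD A₃ A₄ 1 * (eps / (4 * (K₁ * msD A₃ A₄ 1 + 1)))) = eps / 4 * (K₁ * msD A₃ A₄ 1 / (K₁ * msD A₃ A₄ 1 + 1)) := by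
        field_simp
      have h4 : K₁ * msD A₃ A₄ 1 / (K₁ * msD A₃ A₄ 1 + 1) ≤ 1 := by rw [div_le_one (by positivity)]; linarith only []
      have h5 : eps / 4 * (K₁ * msD A₃ A₄ 1 / (K₁ * msD A₃ A₄ 1 + 1)) ≤ eps / 4 := mul_le_of_le_one_right (by positivity) h4
      linarith only [h2, h3, h5]
    rw [hd₁]; linarith only [h1, hR15a, hhi8, heps0.le]
  have hR17 : msD A₃ A₄ 1 * ((π / 2 * lam / (d * B.umin) + π * Kc * eps / d ^ 2) / (B.umin * w / (4 + 2 * A))) + (2 * hi + eps) / d ≤ τ₀ := by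
    have e : msD A₃ A₄ 1 * ((π / 2 * lam / (d * B.umin) + π * Kc * eps / d ^ 2) / (B.umin * w / (4 + 2 * A))) = a₁ * lam + a₂ * eps := by
      rw [ha₁, ha₂]; field_simp
    have h1 : a₁ * lam ≤ τ₀ / 4 := by
      rw [hlam, show a₁ * (τ₀ / (4 * (a₁ + 1))) = τ₀ / 4 * (a₁ / (a₁ + 1)) by field_simp]
      have : a₁ / (a₁ + 1) ≤ 1 := by rw [div_le_one (by positivity)]; linarith only []
      exact mul_le_of_le_one_right (by positivity) this
    have h2 : a₂ * eps + eps / d ≤ τ₀ / 4 := by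
      have h3 : (a₂ + 1 / d) * eps ≤ (a₂ + 1 / d) * (τ₀ / (4 * (a₂ + 1 / d + 1))) := mul_le_mul_of_nonneg_left hepsτ (by positivity)
      have h4 : (a₂ + 1 / d) * (τ₀ / (4 * (a₂ + 1 / d + 1))) = τ₀ / 4 * ((a₂ + 1 / d) / (a₂ + 1 / d + 1)) := by field_simp
      have h5 : (a₂ + 1 / d) / (a₂ + 1 / d + 1) ≤ 1 := by rw [div_le_one (by positivity)]; linarith only []
      have h6 : τ₀ / 4 * ((a₂ + 1 / d) / (a₂ + 1 / d + 1)) ≤ τ₀ / 4 := mul_le_of_le_one_right (by positivity) h5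
      have h7 : a₂ * eps + eps / d = (a₂ + 1 / d) * eps := by ring
      linarith only [h3, h4, h6, h7]
    have h3 : 2 * hi / d ≤ τ₀ / 8 := by
      rw [div_le_iff₀ hDt]
      have := hhi.trans hhi₀τ
      linarith only [this]
    have h4 : (2 * hi + eps) / d = 2 * hi / d + eps / d := by ring
    rw [e, h4]; linarith only [h1, h2, h3, hτ00.le]
  refine ⟨hwin, hR2, hR3, hR4, ?_, ?_, ?_, ?_, ?_, hω₁ ℓ hℓc, hwin.trans (hWtc.trans hω₂), hR11, hR12, hbud ρ hρC, hR15, hR16, hR17⟩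
  · -- hi/2 ≤ Γ
    rw [hΓ]; linarith only [hκℓ0, hK₀.le, hhi, hhi0.le]
  · -- Γ' ceiling
    rw [hΓ']
    have h1 : (Lw + 2 * (Wt / 4)) ^ 2 ≤ Wt ^ 2 := pow_le_pow_left₀ hwin0 hwin 2
    have h2 := mul_le_mul_of_nonneg_left h1 (show 0 ≤ w * B.umin ^ 2 / 2 by positivity)
    linarith only [h2, hK₀.le]
  · -- the fold-box budget
    linarith only [hD_le, hsD, hWD]
  · -- same direction
    have := hsame ρ hρC
    linarith only [this, hτ₀c]
  · -- the cover budget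
    have := hΔc ℓ (Lw + 2 * (Wt / 4)) hℓc (hwin.trans hWtc)
    linarith only [this, hτ₀c]

end Sizes

end Summit.HubbardSuperconductivity.HubbardSuperconductivity.Theorems.C4a

end
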